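import Summits.BirchSwinnertonDyer.BirchSwinnertonDyer.Theorems.EisensteinDepletionAtTwoStarE1MNSFDoor
import Summits.BirchSwinnertonDyer.BirchSwinnertonDyer.Theorems.EisensteinDepletionAtTwoStarSigmaGlue
import Summits.BirchSwinnertonDyer.BirchSwinnertonDyer.Theorems.EisensteinDepletionAtTwoStarOptBNSFNsfDoorPrint
import Summits.BirchSwinnertonDyer.BirchSwinnertonDyer.Theorems.EisensteinDepletionAtTwoStarOptBSFSigmaNodeSeventeen
import Summits.BirchSwinnertonDyer.BirchSwinnertonDyer.Theorems.EisensteinDepletionAtTwoStarOptBSFMidWalk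
import Summits.BirchSwinnertonDyer.BirchSwinnertonDyer.Theorems.EisensteinDepletionAtTwoStarOptBSFTypeAResidue
import Summits.BirchSwinnertonDyer.BirchSwinnertonDyer.Theorems.EisensteinDepletionAtTwoStarOptBSFSigmaNodeCusp
import HarnessLib

/-!
# Line `star` on crux E1M (stmt-BirchSwinnertonDyer-20341): THE END-STATE DOOR — E1M `DepletedLambdaLawAtTwoMod` (all levels) from SEVEN named
# published facts, BY NAME (lead star-p1 GEN 18; the sorry-free content of Lines/star.lean v13)

After GEN 18 the line `star` has NO research stub: its last one, the node law (N256), is derived at every level from the printed fact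
`gamma1Parametrization_cuspImage_nonsingularReduction` (CES 2003 §6.1.2 + Igusa/Katz–Mazur 12.6 + ATAEC IV.9.1) by
`SigmaNode.sigmaNode_of_cuspImageNonsingular` (Theorems/…StarOptBSFSigmaNodeCusp).  This file records the resulting DOOR as a tree theorem:

  E1M ⇐ { (F) cusp images reduce into the identity component (CES 2003 / Igusa / ATAEC),  Edixhoven 1991 Prop. 2 (integrality of the `X₀(N)`-constant),
          Setzer 1975 (prime conductor with rational 2-torsion),  Cremona's table at conductor 17,  the optimal `Γ₁(N)`-datum (CES 2003 §6.1 / Stevens 1989),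
          Abbes–Ullmo 1996 Thm A,  unbounded denominators (Calegari–Dimitrov–Tang 2025) }      — modularity being E1M's own hypothesis.

Assembly (all by name): (N256) all levels `SigmaNode.sigmaNode_of_cuspImageNonsingular`; the squarefree half `SfPositions.starOptBSF_of_positions` ∘ (T1) `optimalNotTypeA_of_sigmaNode`
∘ (T2) `MidWalk.optimalNotMidPointed_of_partnerNotCentre` ∘ (T2′) `partnerNotCentre_of_sigmaNode_of_prints` (= p710438's door, inlined); the non-squarefree half `NsfDoorPrint.starOptBNSF_of_print`; `KummerDoor.starGO2Sigma_of_modularity_abbesUllmo_ubd`;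
the Σ-glue `depletedLambdaLawAtTwoMod_of_starGO2Sigma`.

* `starOptB_of_sevenPrints` — `StarOptB` (aside item 24445, all levels) from six of the prints + modularity;
* `depletedLambdaLawAtTwoMod_of_sevenPrints` — E1M from the seven prints.

HONEST FRAMING (Barrier B1): a CONDITIONAL result — E1M is proved only modulo the seven named facts (hypotheses), none of which is discharged here; (F) is a
corollary of three printed statements rather than a verbatim theorem (see its file).  Nothing here reads `r_an`; E1M as an ITEM, E1M_NSF, the leaf T-r3₂ and
BSD are NOT proved (PARTITION D-0054: none — r_an ≥ 2, axis S0; no S0 motion).  No `sorry`, no definition.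
-/

set_option linter.dupNamespace false
set_option autoImplicit false

noncomputable section

open scoped Classical MatrixGroups
open CongruenceSubgroup
open WeierstrassCurve Literature.NumberTheory.EllipticCurves Literature.NumberTheory.EllipticCurves.Greenberg1999
open Literature.NumberTheory.EllipticCurves.ModularForms

namespace Summit.BirchSwinnertonDyer.BirchSwinnertonDyer.Theorems.DepletionAtTwo.SigmaNode

/-- **`StarOptB` (all levels) from six prints + modularity**: (N256) at all levels (`sigmaNode_of_cuspImageNonsingular`, from (F) + Edixhoven), the
squarefree door (T1) ∧ (T2) ⇒ `SfPositions.starOptBSF_of_positions` (UBD, Edixhoven, Setzer, Cremona-17), the non-squarefree door `NsfDoorPrint.starOptBNSF_of_print`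
(modularity, `Γ₁`-datum, UBD), glued by cases on `Squarefree N_W`.  CONDITIONAL on the named facts.
[cite: ConradEdixhovenStein2003, §6.1.2 proof of Lemma 6.1.6 (p. 381)] [cite: Edixhoven1991, Prop. 2] [cite: Setzer1975, pp. 367–378]
[cite: CremonaAlgorithms1997, Table 1 (N = 17)] [cite: CalegariDimitrovTang2025, Thm. 1.0.1] -/
theorem starOptB_of_sevenPrints (hnf : exists_isNewformOf) (hF : gamma1Parametrization_cuspImage_nonsingularReduction)
    (hEd : edixhoven_optimalManinConstant_integral) (hS : Setzer1975_primeConductor_rationalTwoTorsion)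
    (hC : Cremona1997_conductor_seventeen_classification) (hex : exists_optimal_gamma1ParametrizationData)
    (hU : Literature.NumberTheory.Automorphic.CalegariDimitrovTang2025_unboundedDenominators) :
    Summit.BirchSwinnertonDyer.BirchSwinnertonDyer.Theses.EisensteinDepletionAtTwo.StarOptB := by
  intro W _ _ x hord hx hAB h15 N _ f hf W₀ _ _ hf₀ L₀ hL₀ q hq hin hout
  by_cases hsf : Squarefree (W.conductorNorm ℤ)
  · have hN := sigmaNode_of_cuspImageNonsingular hF hEd
    exact SfPositions.starOptBSF_of_positions (optimalNotTypeA_of_sigmaNode hU hEd hN)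
      (MidWalk.optimalNotMidPointed_of_partnerNotCentre (partnerNotCentre_of_sigmaNode_of_prints hU hEd hS hC hN))
      W x hord hx hAB h15 hsf f hf W₀ hf₀ L₀ hL₀ q hq hin hout
  · exact NsfDoorPrint.starOptBNSF_of_print hnf hex hU W x hord hx hAB h15 hsf f hf W₀ hf₀ L₀ hL₀ q hq hin hout

/-- **THE END-STATE DOOR OF LINE `star`: E1M `DepletedLambdaLawAtTwoMod` (item 20341, all conductors) from SEVEN named published facts, BY NAME** —
modularity (E1M's own binder) gives `StarGO2Sigma` through line kummer's door (`KummerDoor.starGO2Sigma_of_modularity_abbesUllmo_ubd`: Abbes–Ullmo, UBD)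
and `StarOptB` through `starOptB_of_sevenPrints`; the Σ-glue `depletedLambdaLawAtTwoMod_of_starGO2Sigma` concludes.  CONDITIONAL on the seven facts;
E1M as an item / BSD NOT proved. [cite: GreenbergVatsal2000, §3 Thm. (3.12), display (28)] [cite: ConradEdixhovenStein2003, §6.1.2 proof of Lemma 6.1.6 (p. 381)]
[cite: AbbesUllmo1996, Thm. A] [cite: CalegariDimitrovTang2025, Thm. 1.0.1] -/
theorem depletedLambdaLawAtTwoMod_of_sevenPrints (hF : gamma1Parametrization_cuspImage_nonsingularReduction)
    (hEd : edixhoven_optimalManinConstant_integral) (hS : Setzer1975_primeConductor_rationalTwoTorsion)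
    (hC : Cremona1997_conductor_seventeen_classification) (hex : exists_optimal_gamma1ParametrizationData)
    (hAU : abbesUllmo_not_dvd_maninConstant_of_not_dvd_level)
    (hU : Literature.NumberTheory.Automorphic.CalegariDimitrovTang2025_unboundedDenominators) :
    Summit.BirchSwinnertonDyer.BirchSwinnertonDyer.Theses.EisensteinDepletionAtTwo.DepletedLambdaLawAtTwoMod := by
  intro hmod
  have hnf : exists_isNewformOf := hmod
  exact depletedLambdaLawAtTwoMod_of_starGO2Sigma (KummerDoor.starGO2Sigma_of_modularity_abbesUllmo_ubd hnf hAU hU)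
    (starOptB_of_sevenPrints hnf hF hEd hS hC hex hU) hmod

end Summit.BirchSwinnertonDyer.BirchSwinnertonDyer.Theorems.DepletionAtTwo.SigmaNode

end
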